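import Summits.AtomisticToContinuum.Crystallization.Theorems.FrustratedLawDichotomyStrainedPatchPairTube

/-!
# Strained patch · «PairTube» record SHAPE: the score-relevant cone (decomp-a2c lens-5 g84; HOME-only; lands third, after `…PairTubeA` / `…PairTube`)

The census instrument PAIR-84 fits ONE pair table: the cone `β + s·ℓ` on the SCORE-RELEVANT pairs — host bond length `ℓ ≤ 9/2` (the range of
`effPot w₄₅ ω₄` and of the `Collar (9/2)` flags) with at least one end in the host's `RE`-core (`RE ≥ 9/5`, the averaging radius of
`ballAvg (9/5)`) — and the DIPOLE value `2τ₀` on every other pair, where the clause is implied by the scalar boxes (`relCone_outer_vacuous`):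
the cover (T-side) pays only where the certificate (E-side) reads.  This file fixes that SHAPE `relCone RE β s τ₀` with GENERIC numerals and
states the record cell / the crux BY NAME over it; the census result is then ONE instantiation line `(RE, β, s) := …` (memo NODE-g84 §5).
[formal bookkeeping] throughout; 0 sorry.
-/

noncomputable section

namespace Summit.AtomisticToContinuum.Crystallization.Theorems.FrustratedLawDichotomyStrainedPatchPairTube

open scoped BigOperators Classical
open Summit.AtomisticToContinuum.Crystallization.Theorems.ChargedEnergyGapNegative (eStar E3)
open Summit.AtomisticToContinuum.Crystallization.Theorems.FrustratedLawDichotomyRangeCut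
open Summit.AtomisticToContinuum.Crystallization.Theorems.FrustratedLawDichotomySchurCut
open Summit.AtomisticToContinuum.Crystallization.Theorems.FrustratedLawDichotomyMotifLemmas (GoodAtScale)
open Summit.AtomisticToContinuum.Crystallization.Theorems.FrustratedLawDichotomyAveragingCut (ballAvg)
open Summit.AtomisticToContinuum.Crystallization.Theorems.FrustratedLawDichotomyExemptLocOpt (LocOptFails)
open Summit.AtomisticToContinuum.Crystallization.Theorems.FrustratedLawDichotomyExemptSplit (SchurElasticPricingX)
open Summit.AtomisticToContinuum.Crystallization.Theorems.FrustratedLawDichotomyExemptAbsorptionRecord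
open Summit.AtomisticToContinuum.Crystallization.Theorems.FrustratedLawDichotomyCollarCensus
open Summit.AtomisticToContinuum.Crystallization.Theorems.FrustratedLawDichotomyCollarCensusKappa
open Summit.AtomisticToContinuum.Crystallization.Theorems.FrustratedLawDichotomyStrainedPatchHomSplit
open Summit.AtomisticToContinuum.Crystallization.Theorems.FrustratedLawDichotomyStrainedPatchCleanCollar (CleanBall TailPenalty AnnularDefectFloor
  DefectiveCollarFloor)
open Summit.AtomisticToContinuum.Crystallization.Theorems.FrustratedLawDichotomyStrainedPatchPhaseCut (MonoPhaseBall AnnularPhaseFloor PolyTextureFloor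
  monoPhaseBall_comp_iff)
open Summit.AtomisticToContinuum.Crystallization.Theorems.FrustratedLawDichotomyStrainedPatchCoreTube (NearHomIsoAt CoreOffTubeFloor nearHomIsoAt_comp_iff)
open Summit.AtomisticToContinuum.Crystallization.Theorems.FrustratedLawDichotomyStrainedPatchCoreTubeRecord (CoreCoreRelief)
open Summit.AtomisticToContinuum.Crystallization.Theorems.FrustratedLawDichotomyStrainedPatchStrainBands (EdgeFarFloor coreOff_iff_edge_and_soft
  softFarFloor_eighth)
open Summit.AtomisticToContinuum.Crystallization.Theorems.FrustratedLawDichotomyStrainedPatchHomIsometry (admissible_comp_iff goodAtScale_comp_iff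
  dist_comp injective_comp_iff)
open Summit.AtomisticToContinuum.Crystallization.Theorems.FrustratedLawDichotomyStrainedPatchHomTubeIso (cleanBall_comp_iff ballAvg_xRec_comp)
open Summit.AtomisticToContinuum.Crystallization.Theorems.FrustratedLawDichotomyStrainedPatchChartFamilies (ChartBy FamilyLE familyLE_refl
  ChartBy.mono_t ChartBy.mono_family)
open Summit.AtomisticToContinuum.Crystallization.Theorems.FrustratedLawDichotomyStrainedPatchHostCells (TubeFloor FamilyCover FamP)
open Summit.AtomisticToContinuum.Crystallization.Theorems.FrustratedLawDichotomyStrainedPatchQuantSlaving (ChartFam SlackTab)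
open Summit.AtomisticToContinuum.Crystallization.Theorems.FrustratedLawDichotomyStrainedPatchGradedTube
open Summit.AtomisticToContinuum.Crystallization.Theorems.FrustratedLawDichotomyStrainedPatchCoverBridge
open Summit.AtomisticToContinuum.Crystallization.Theorems.FrustratedLawDichotomyAperiodicGapRecordJunctionCore
  (aperiodicFrustratedLawGap_of_homFloor_625_of_coreOff periodicFrustratedLawGap_of_homFloor_625_of_coreOff)

/-! ## §1. The score-relevant cone -/

/-- ★ `relCone RE β s τ₀` — the cone `β + s·|z₀ a − z₀ b|` on the SCORE-RELEVANT host pairs (`|z₀ a − z₀ b| ≤ 9/2` and `min` host radius `≤ RE`),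
the dipole value `2τ₀` elsewhere (vacuous under the scalar boxes). The census's fit target (PAIR-84-T) and certificate table (PAIR-84-E). -/
def relCone (RE β s τ₀ : ℝ) : PairTab := fun _ z₀ c₀ a b =>
  if dist (z₀ a) (z₀ b) ≤ 9 / 2 ∧ min (dist (z₀ a) (z₀ c₀)) (dist (z₀ b) (z₀ c₀)) ≤ RE then β + s * dist (z₀ a) (z₀ b) else 2 * τ₀

section RelCone

variable {𝓘 : ChartFam} {RE RE' β β' s s' τ₀ : ℝ} {M : ℕ} {z : Fin M → E3} {c : Fin M} {M₀ : ℕ} {z₀ : Fin M₀ → E3} {c₀ : Fin M₀} {e : Fin M → Fin M₀}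

/-- `relCone_of_rel` (docstring added by the landing lane; see the module docstring). [formal bookkeeping] -/
theorem relCone_of_rel {a b : Fin M₀} (h : dist (z₀ a) (z₀ b) ≤ 9 / 2 ∧ min (dist (z₀ a) (z₀ c₀)) (dist (z₀ b) (z₀ c₀)) ≤ RE) :
    relCone RE β s τ₀ M₀ z₀ c₀ a b = β + s * dist (z₀ a) (z₀ b) := by
  unfold relCone; rw [if_pos h]

/-- `relCone_of_not_rel` (docstring added by the landing lane; see the module docstring). [formal bookkeeping] -/
theorem relCone_of_not_rel {a b : Fin M₀} (h : ¬(dist (z₀ a) (z₀ b) ≤ 9 / 2 ∧ min (dist (z₀ a) (z₀ c₀)) (dist (z₀ b) (z₀ c₀)) ≤ RE)) :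
    relCone RE β s τ₀ M₀ z₀ c₀ a b = 2 * τ₀ := by
  unfold relCone; rw [if_neg h]

/-- ★ OUTER VACUITY: on a score-IRRELEVANT pair the clause of `relCone` is implied by the scalar boxes `‖D‖ ≤ τ₀` — the cover pays nothing there.
[formal bookkeeping] -/
theorem relCone_outer_vacuous (h : ChartByG 𝓘 τ₀ (constTol τ₀) z c z₀ c₀ e) {a b : Fin M} (ha : dist (z a) (z c) ≤ 63 / 10)
    (hb : dist (z b) (z c) ≤ 63 / 10)
    (hout : ¬(dist (z₀ (e a)) (z₀ (e b)) ≤ 9 / 2 ∧ min (dist (z₀ (e a)) (z₀ c₀)) (dist (z₀ (e b)) (z₀ c₀)) ≤ RE)) :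
    dist (z a - z b) (z₀ (e a) - z₀ (e b)) ≤ relCone RE β s τ₀ M₀ z₀ c₀ (e a) (e b) := by
  have h₁ : dist (z a - z b) (z₀ (e a) - z₀ (e b)) ≤ constTol τ₀ M₀ z₀ c₀ (e a) + constTol τ₀ M₀ z₀ c₀ (e b) := by
    rw [dist_eq_norm, disp_diff_eq]
    exact h.disp_diff ha hb
  simp only [constTol] at h₁
  rw [relCone_of_not_rel hout]
  linarith

/-- ★ Hence a SCALAR chart is a `relCone`-chart as soon as the cone holds on the score-relevant pairs only. [formal bookkeeping] -/
theorem chartByGB_relCone_of_rel (h : ChartByG 𝓘 τ₀ (constTol τ₀) z c z₀ c₀ e)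
    (hrel : ∀ a b, dist (z a) (z c) ≤ 63 / 10 → dist (z b) (z c) ≤ 63 / 10 →
      dist (z₀ (e a)) (z₀ (e b)) ≤ 9 / 2 ∧ min (dist (z₀ (e a)) (z₀ c₀)) (dist (z₀ (e b)) (z₀ c₀)) ≤ RE →
        dist (z a - z b) (z₀ (e a) - z₀ (e b)) ≤ β + s * dist (z₀ (e a)) (z₀ (e b))) :
    ChartByGB 𝓘 τ₀ (constTol τ₀) (relCone RE β s τ₀) z c z₀ c₀ e := by
  refine ⟨h, fun a b ha hb => ?_⟩
  by_cases hr : dist (z₀ (e a)) (z₀ (e b)) ≤ 9 / 2 ∧ min (dist (z₀ (e a)) (z₀ c₀)) (dist (z₀ (e b)) (z₀ c₀)) ≤ RE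
  · rw [relCone_of_rel hr]; exact hrel a b ha hb hr
  · exact relCone_outer_vacuous h ha hb hr

/-- MONOTONICITY of the shape: a smaller core radius, a larger intercept and a larger (non-negative) slope give a LARGER (looser) table, provided
the cone stays below the dipole value on the relevant pairs (`β' + s'·(9/2) ≤ 2τ₀`). [formal bookkeeping] -/
theorem relCone_mono (hRE : RE' ≤ RE) (hβ : β ≤ β') (hs : s ≤ s') (hs'0 : 0 ≤ s') (hcap : β' + s' * (9 / 2) ≤ 2 * τ₀) :
    PairLE (relCone RE β s τ₀) (relCone RE' β' s' τ₀) := by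
  intro M₀ z₀ c₀ a b
  by_cases hr : dist (z₀ a) (z₀ b) ≤ 9 / 2 ∧ min (dist (z₀ a) (z₀ c₀)) (dist (z₀ b) (z₀ c₀)) ≤ RE
  · rw [relCone_of_rel hr]
    by_cases hr' : dist (z₀ a) (z₀ b) ≤ 9 / 2 ∧ min (dist (z₀ a) (z₀ c₀)) (dist (z₀ b) (z₀ c₀)) ≤ RE'
    · rw [relCone_of_rel hr']
      have := mul_le_mul_of_nonneg_right hs (dist_nonneg : 0 ≤ dist (z₀ a) (z₀ b))
      linarith
    · rw [relCone_of_not_rel hr']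
      have h₁ : s * dist (z₀ a) (z₀ b) ≤ s' * (9 / 2) :=
        (mul_le_mul_of_nonneg_right hs dist_nonneg).trans (mul_le_mul_of_nonneg_left hr.1 hs'0)
      linarith
  · rw [relCone_of_not_rel hr]
    have hr' : ¬(dist (z₀ a) (z₀ b) ≤ 9 / 2 ∧ min (dist (z₀ a) (z₀ c₀)) (dist (z₀ b) (z₀ c₀)) ≤ RE') :=
      fun h' => hr ⟨h'.1, h'.2.trans hRE⟩
    rw [relCone_of_not_rel hr']

end RelCone

/-! ## §2. The record cell over the shape (numerals generic; the census pins `(RE, β, s)` at `τ₀ = 1/25`) -/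

section RecordCell

variable {𝓘 : ChartFam} {RE β s τ₀ : ℝ}

/-- ★★ THE SCORE-RELEVANT PAIR CELL: `(TF-GB) ∧ (BC-GB)` at `(τ₀, constTol τ₀, relCone RE β s τ₀)` ⟹ [CORE-FAR] of record. [formal bookkeeping] -/
theorem coreOff_record_of_relConeCell (hT : TubeFloorGB 𝓘 τ₀ (constTol τ₀) (relCone RE β s τ₀))
    (hC : FamilyCoverGB 𝓘 (24 / 5) (1 / 100) (1 / 8) τ₀ (constTol τ₀) (relCone RE β s τ₀)) :
    CoreOffTubeFloor (63 / 10) (63 / 10) (24 / 5) (1 / 100) 0 :=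
  coreOff_record_of_purePairCell hT hC

/-- ★ TRADE inside the shape: a certificate at a LOOSER cone and a cover at a TIGHTER one close the cell. [formal bookkeeping] -/
theorem coreOff_record_of_relConeCell_of_le {RE' β' s' : ℝ} (hRE : RE' ≤ RE) (hβ : β ≤ β') (hs : s ≤ s') (hs'0 : 0 ≤ s')
    (hcap : β' + s' * (9 / 2) ≤ 2 * τ₀) (hT : TubeFloorGB 𝓘 τ₀ (constTol τ₀) (relCone RE' β' s' τ₀))
    (hC : FamilyCoverGB 𝓘 (24 / 5) (1 / 100) (1 / 8) τ₀ (constTol τ₀) (relCone RE β s τ₀)) :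
    CoreOffTubeFloor (63 / 10) (63 / 10) (24 / 5) (1 / 100) 0 :=
  coreOff_record_of_relConeCell (hT.anti_pair (relCone_mono hRE hβ hs hs'0 hcap)) hC

/-- ★★★ THE CRUX BY NAME over the score-relevant pair cell (record data of `…RecordJunctionCore`). [folklore instantiation] -/
theorem aperiodicFrustratedLawGap_of_homFloor_625_of_relConeCell {εE CE DE DX : ℝ}
    (hε0 : 0 < εE) (hε1 : εE ≤ 1 / 10000) (hU : PeriodicEnergyCeiling (-(7175 / 10000))) (hDX : 0 ≤ DX)
    (hE : SchurElasticPricingX (1 / 20) (1 / 8) w₄₅ ω₄ (3 / 400) (-(7175 / 10000)) (1 / 10000) CE DE DX (LocOptFails eStar εE (3 / 2) 1))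
    (hHF : HomFloor (1 / 625)) (hTP : TailPenalty (24 / 5) (1 / 1000)) (hRl : CoreCoreRelief (63 / 10) (63 / 10) (24 / 5) (1 / 100) (3 / 5000))
    (hTF : TubeFloorGB 𝓘 τ₀ (constTol τ₀) (relCone RE β s τ₀))
    (hBC : FamilyCoverGB 𝓘 (24 / 5) (1 / 100) (1 / 8) τ₀ (constTol τ₀) (relCone RE β s τ₀))
    (hF : AnnularPhaseFloor (63 / 10) (24 / 5) (63 / 10) (1 / 1000))
    (hP : PolyTextureFloor (63 / 10) (24 / 5) (1 / 1000)) (hA : AnnularDefectFloor (24 / 5) (63 / 10)) (hD : DefectiveCollarFloor (24 / 5))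
    (h2 : CrowdedCoreMotifPricingCapK (1 / 1000) (9 / 5) (133 / 10) (3 / 2) (effPot w₄₅ ω₄ (3 / 400)) (-(7175 / 10000) + 3 / 400)
      (Collar (9 / 2) fun N y j => (∃ s : ℝ, 0 ≤ s ∧ s ≤ 3 / 2 ∧ NonEquilibriumCore (-(7175 / 10000)) 0 7 s (1 / 10000) N y j) ∨
        GoodAtScale (1 / 20) (3 / 2) y j))
    (h3 : DiluteDefectMotifPricingCapK (1 / 1000) (9 / 5) (133 / 10) (3 / 2) (effPot w₄₅ ω₄ (3 / 400)) (-(7175 / 10000) + 3 / 400)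
      (Collar (9 / 2) fun N y j => (∃ s : ℝ, 0 ≤ s ∧ s ≤ 3 / 2 ∧ NonEquilibriumCore (-(7175 / 10000)) 0 7 s (1 / 10000) N y j) ∨
        GoodAtScale (1 / 20) (3 / 2) y j)) :
    Summit.AtomisticToContinuum.Crystallization.Theses.FrustratedLawDichotomy.AperiodicFrustratedLawGap :=
  aperiodicFrustratedLawGap_of_homFloor_625_of_pairTube hε0 hε1 hU hDX hE hHF hTP hRl hTF hBC hF hP hA hD h2 h3

end RecordCell

end Summit.AtomisticToContinuum.Crystallization.Theorems.FrustratedLawDichotomyStrainedPatchPairTube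

end
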